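import Summits.QuantumAdvantage.QuantumAdvantage.Theorems.SosSandwichTransferPBWalkMachineCount
import Summits.QuantumAdvantage.QuantumAdvantage.Theorems.SosSandwichTransferPBWalkMachineLength
import HarnessLib

/-!
# Crux `TransferPB` (stmt-QuantumAdvantage-15238, route SosSandwich), line `birth` — the stub from (Q) and the polynomial TIME of the reference machine

Assembly of the machine half of stub `stub_pbOracleSimulation`. The reference transcript machine
`walkMachine Wf Df` (`Theorems/SosSandwichTransferPBWalkMachineDefs.lean`) has the right RUNS for every answer
function and oracle (`run_walkMachine`), asks polynomially many queries under consistency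
(`queryCount_machineComp_le_of_consistent`) and only short queries (`length_le_of_mem_queries_walkMachine`). Hence:

* `liveBoundNat_mono` — the live-level bound is monotone in the number of oracle gates;
* **`stub_pbOracleSimulation_of_polyTimeWalkMachine`** (round/length budget: an explicit polynomial built from a
  size polynomial of `F` — `IsUniform.isPolySize'` — the bound polynomial `p` of `Wf, Df`, `r`, `c`, `k`) — the registered stub follows from
  (Q) `nodeProblem F r c k ∈ PromiseBQP` and
  (P) for all `c k`, uniform `F`, `r`: SOME width/budget functions `Wf, Df : List Bool → ℕ` with
      `oracleWidth F x ≤ Wf x ≤ p(|x|)`, `machineBudget F x r c k ≤ Df x ≤ p(|x|)` for a polynomial `p`, such that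
      the reference machine's step function is polynomial-time: `(walkMachine Wf Df).IsPolyTime encodingBoolBool`.

So the machine half is reduced to ONE `FP` statement about an explicit step function (plus the choice of two
polynomial-time integer functions dominating `n + ancillas(n)` and `machineBudget`, both available from the
uniformity machine of `F`). All proved here; (Q) and (P) are plain `Prop` arguments (no named fact).
Source: S. Aaronson, A. Ambainis, Theory Comput. 10 (2014), proof of Thm. 23 (p. 14).
-/

-- D-0017: single-conjunct summit ⇒ the duplicate `QuantumAdvantage.QuantumAdvantage` is mandated.
set_option linter.dupNamespace false

noncomputable section

namespace Summit.QuantumAdvantage.QuantumAdvantage.Cruxes.TransferPB.Birth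

open Finset Literature.Computability.Cryptography Literature.Computability.Complexity
  Literature.Computability.QuantumComplexity Literature.Computability.QuantumComplexity.ClassicalSimulation
open Summit.QuantumAdvantage.QuantumAdvantage.Theses.SosSandwich

namespace SimTreePB

variable {F : QCircuitFamily cliffordT} {x : List Bool} {r : Polynomial ℕ} {c k : ℕ}

/-- The live-level bound is monotone in the number of oracle gates: with `T ≤ S`,
`8T²·2^k·(400(2T+1)(r(n)+1))^c ≤ 8S²·2^k·(400(2S+1)(r(n)+1))^c`. [folklore] -/
theorem liveBoundNat_mono {S : ℕ} (hs : (F.circ x.length).oracleQueries ≤ S) :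
    8 * (F.circ x.length).oracleQueries ^ 2 * 2 ^ k * (400 * thm23Degree F x * (r.eval x.length + 1)) ^ c ≤
      8 * S ^ 2 * 2 ^ k * (400 * (2 * S + 1) * (r.eval x.length + 1)) ^ c := by
  unfold thm23Degree
  gcongr

/-- **The stub from (Q) and the polynomial time of the reference machine.** If (Q) `nodeProblem F r c k ∈ PromiseBQP`
for all `c, k`, uniform `F`, `r`, and (P) for the same data there are width/budget functions `Wf, Df` dominating
`oracleWidth F x` and `machineBudget F x r c k`, bounded by a polynomial in `|x|`, for which the reference transcript
machine `walkMachine Wf Df` has a polynomial-time step function, then the registered stub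
`Sig.stub_pbOracleSimulation` holds. [cite: AaronsonAmbainis2014, Thm. 23 (proof, p. 14)] -/
theorem stub_pbOracleSimulation_of_polyTimeWalkMachine
    (hQ : ∀ (c k : ℕ) (F : QCircuitFamily cliffordT), F.IsUniform → ∀ r : Polynomial ℕ,
      nodeProblem F r c k ∈ Literature.Computability.Cryptography.PromiseBQP)
    (hP : ∀ (c k : ℕ) (F : QCircuitFamily cliffordT), F.IsUniform → ∀ r : Polynomial ℕ,
      ∃ (Wf Df : List Bool → ℕ) (p : Polynomial ℕ),
        (walkMachine Wf Df).IsPolyTime Computability.encodingBoolBool ∧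
        ∀ x : List Bool, oracleWidth F x ≤ Wf x ∧ machineBudget F x r c k ≤ Df x ∧
          Wf x ≤ p.eval x.length ∧ Df x ≤ p.eval x.length) :
    Sig.stub_pbOracleSimulation := by
  refine stub_pbOracleSimulation_of_stringMachines hQ fun c k F hF r => ?_
  obtain ⟨Wf, Df, p, hpoly, hbd⟩ := hP c k F hF r
  obtain ⟨s, hs⟩ := QCircuitFamily.IsUniform.isPolySize' hF
  -- the live-level bound and the round/length budget as polynomials in `n`
  let Lp : Polynomial ℕ :=
    Polynomial.C 8 * s ^ 2 * Polynomial.C (2 ^ k) * (Polynomial.C 400 * (Polynomial.C 2 * s + 1) * (r + 1)) ^ c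
  let q : Polynomial ℕ :=
    (p * (p * (1 + Polynomial.C 2 * p * Lp) + p * Lp + 1) + Polynomial.C 40) +
      (Polynomial.C 2 * Polynomial.X + Polynomial.C 2 * p * (Polynomial.C 2 * p + Polynomial.C 4) + p + Polynomial.C 50) + 1
  have hLp : ∀ n : ℕ, Lp.eval n = 8 * (s.eval n) ^ 2 * 2 ^ k * (400 * (2 * s.eval n + 1) * (r.eval n + 1)) ^ c := by
    intro n; simp [Lp]
  have hq : ∀ n : ℕ, q.eval n =
      (p.eval n * (p.eval n * (1 + 2 * p.eval n * Lp.eval n) + p.eval n * Lp.eval n + 1) + 40) +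
        (2 * n + 2 * p.eval n * (2 * p.eval n + 4) + p.eval n + 50) + 1 := by
    intro n; simp [q]
  refine ⟨walkMachine Wf Df, q, hpoly, fun O x y hy => ?_, fun x _ g _ hgn => ?_⟩
  · -- query lengths
    obtain ⟨-, -, hWp, hDp⟩ := hbd x
    have hlen := length_le_of_mem_queries_walkMachine Wf Df O _ x hy
    rw [hq]
    have h1 : 2 * Df x * (2 * Wf x + 4) ≤ 2 * p.eval x.length * (2 * p.eval x.length + 4) := by gcongr
    omega
  · -- runs within the round budget
    obtain ⟨hW, hD, hWp, hDp⟩ := hbd x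
    refine ⟨Wf x, Df x, hW, hD, fun A => ?_⟩
    apply run_walkMachine
    have hT : (F.circ x.length).oracleQueries ≤ s.eval x.length :=
      (QCircuit.oracleQueries_le_size _).trans (hs x.length).1
    have hB := liveBoundNat_mono (r := r) (c := c) (k := k) hT
    rw [← hLp] at hB
    have hcnt := queryCount_machineComp_le_of_consistent (decodeBool_combined_true A g) hgn Wf Df hW
    set B := 8 * (F.circ x.length).oracleQueries ^ 2 * 2 ^ k * (400 * thm23Degree F x * (r.eval x.length + 1)) ^ c
      with hBdef
    rw [hq]
    have h2 : Df x * (Wf x * (1 + 2 * Wf x * B) + Wf x * B + 1) ≤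
        p.eval x.length * (p.eval x.length * (1 + 2 * p.eval x.length * Lp.eval x.length) +
          p.eval x.length * Lp.eval x.length + 1) := by
      gcongr
    omega

end SimTreePB

end Summit.QuantumAdvantage.QuantumAdvantage.Cruxes.TransferPB.Birth

end
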